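import Literature.Geometry.DiscreteGeometry.ThreePointBoundGeneral
import Summits.Ventures.PackingBounds.Energy.TenPointPetQ2Facc1
import Summits.Ventures.PackingBounds.Energy.TenPointPetQ2Fgrp2
import Summits.Ventures.PackingBounds.Energy.TenPointPetQ2Fblk0
import Summits.Ventures.PackingBounds.Energy.TenPointPetQ2Fblk1
import Summits.Ventures.PackingBounds.Energy.TenPointPetQ2Fblk2
import Summits.Ventures.PackingBounds.Energy.TenPointPetQ2Fblk3
import Summits.Ventures.PackingBounds.Energy.TenPointPetQ2Fblk4
import Summits.Ventures.PackingBounds.Energy.TenPointPetQ2Fblk5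
import HarnessLib

/-!
# `TenPointPetQ2`: the tree's factored three-point function `threePointF 4 6 6 dcoKPQ2 gwKPQ2` equals the expansion `FexpKPQ2`

Framing: lottery ticket; floor = certified bounds/negative ranges. Venture `PackingBounds`, cell
`pub-packcert`, energy family E3PT (pub-packcert-energy gen 14; n = 4 kernel route = KERNEL-D6 data route + `threePointF 4`).
-/

noncomputable section

open Finset

namespace Summit.Ventures.PackingBounds.Energy.TenPointPetQ2

open Literature.Geometry.DiscreteGeometry Literature.Geometry.DiscreteGeometry.BachocVallentin

/-- `Σ_{k<6} f k` written out. -/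
private theorem sum_range_blocksPQ2 (f : ℕ → ℝ) : ∑ k ∈ range 6, f k = f 0 + f 1 + f 2 + f 3 + f 4 + f 5 := by
  simp [Finset.sum_range_succ]

set_option maxRecDepth 20000 in
set_option maxHeartbeats 400000000 in
/-- The last staged partial sum lands on `FexpKPQ2` (`ring`). -/
theorem fgrp_top_eqPQ2 (u v t : ℝ) : Facc1KPQ2 u v t + Fgrp2KPQ2 u v t = FexpKPQ2 u v t := by
  unfold Facc1KPQ2 Fgrp2KPQ2 FexpKPQ2
  ring

/-- The tree's factored three-point function (`ThreePointBoundGeneral.threePointF`, `n = 4`) equals `FexpKPQ2` (blockwise identities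
`fblk<k>_eq`, staged sums, `linear_combination`). -/
theorem threePointF_eqPQ2 (u v t : ℝ) : threePointF 4 6 6 dcoKPQ2 gwKPQ2 u v t = FexpKPQ2 u v t := by
  rw [threePointF, sum_range_blocksPQ2, fblk0_eqPQ2, fblk1_eqPQ2, fblk2_eqPQ2, fblk3_eqPQ2, fblk4_eqPQ2, fblk5_eqPQ2]
  linear_combination fgrp0_eqPQ2 u v t + fgrp1_eqPQ2 u v t + fgrp2_eqPQ2 u v t + facc1_eqPQ2 u v t + fgrp_top_eqPQ2 u v t

end Summit.Ventures.PackingBounds.Energy.TenPointPetQ2
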